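import Summits.KontsevichZagierPeriods.KontsevichZagierPeriods.Theorems.SoloBlindLevelNine
import Summits.KontsevichZagierPeriods.KontsevichZagierPeriods.Theorems.SoloBlindLevelEight
import Summits.KontsevichZagierPeriods.KontsevichZagierPeriods.Theorems.SoloBlindQuartic
import Summits.KontsevichZagierPeriods.KontsevichZagierPeriods.Theorems.SoloBlindEnneaCover
import HarnessLib

/-!
# Level 18, first kind: the twenty-seven `S₃`-orbits collapse to four classes

At level `18` the first-kind exponent triples `{k, l, 18-k-l}` form `27` `S₃`-orbits and FOUR
Deligne–Koblitz–Ogus classes (we write `{a,b,c}` for `{a/18, b/18, c/18}`):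

* `A = {1,1,16} ∪ {1,8,9} ∪ {1,4,13} ∪ {2,8,8} ∪ {4,6,8} ∪ {1,6,11} ∪ {3,4,11}` (`β(1/18,1/18)`),
* `B = {2,2,14} ∪ {2,7,9} ∪ {1,7,10} ∪ {2,6,10} ∪ {3,5,10} ∪ {4,7,7} ∪ {5,6,7}` (`β(1/9,1/9)`),
* `C = {4,4,10} ∪ {4,5,9} ∪ {2,4,12} ∪ {2,5,11} ∪ {1,2,15} ∪ {5,5,8} ∪ {1,5,12}` (`β(2/9,2/9)`),
* `D = {3,3,12} ∪ {3,6,9} ∪ {6,6,6} ∪ {2,3,13} ∪ {3,7,8} ∪ {1,3,14}` (`β(1/6,1/6)`).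

Inside the Kontsevich–Zagier rules all `23` merges are available: duplication (`×8`), mixed
duplication (`×3`), triplication (`3a+b=1`: `×5`; `3a+b=2`: `×2`), the quartic family (`×4`),
the twisted quartic family (`×2`), and the level-18 cover merge `β(1/9,1/6) ≐ β(1/6,1/3)` of
`SoloBlindEnneaCover` (the only one that is not an instance of a one-parameter family). Hence

* `firstSpan_eighteen_eq`: `V₁₈^I = K₀ x_π + K₀ β(1/18,1/18) + K₀ β(1/9,1/9) + K₀ β(2/9,2/9)
  + K₀ β(1/6,1/6)`;
* `kz_levelEighteenFirst`: if the five periods `π, Γ(1/18)²/Γ(1/9), Γ(1/9)²/Γ(2/9),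
  Γ(2/9)²/Γ(4/9), Γ(1/6)²/Γ(1/3)` (one per Deligne–Koblitz–Ogus class) are linearly independent
  over `K₀ = ℚ̄ ∩ ℝ`, the period map is injective on `V₁₈^I`.

References: J. Wolfart, G. Wüstholz, Math. Ann. 273 (1985) 1–15; P. Deligne (appendix by
N. Koblitz, A. Ogus), PSPM 33.2 (1979); N. Aoki, Amer. J. Math. 113 (1991) 779–833.
-/

noncomputable section

open Set

namespace Summit.KontsevichZagierPeriods.KontsevichZagierPeriods.Theorems

namespace SoloBlind

open Literature.NumberTheory.Transcendental
open Literature.NumberTheory.Transcendental.KZ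

/-- First-kind orbit representatives at level 18 (one pair per `S₃`-orbit). -/
def reps18 : Finset (ℕ × ℕ) :=
  {(1, 1), (1, 9), (4, 13), (8, 8), (4, 6), (1, 6), (11, 3),
    (2, 2), (2, 9), (1, 10), (10, 6), (5, 3), (7, 7), (6, 7),
    (4, 4), (4, 9), (2, 12), (2, 11), (1, 15), (5, 5), (12, 5),
    (3, 3), (3, 9), (6, 6), (2, 3), (7, 8), (1, 14)}

/-- `reps18` meets all `27` first-kind `S₃`-orbits at level 18. -/
theorem representsFirst18 : RepresentsFirst 18 reps18 := by decide +kernel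

/-- The five level-18 generators `x_π, β(1/18,1/18), β(1/9,1/9), β(2/9,2/9), β(1/6,1/6)`. -/
def eighteenGens : Fin 5 → Q :=
  ![xPi, betaQ (1 / 18) (1 / 18), betaQ (1 / 9) (1 / 9), betaQ (2 / 9) (2 / 9),
    betaQ (1 / 6) (1 / 6)]

/-- The span of the five generators. -/
def eighteenSpan : Submodule K₀ Q := Submodule.span K₀ (range eighteenGens)

/-! ## Class A -/

/-- `β(1/18,1/18) ∈ ⟨eighteenGens⟩`. -/
theorem a1_1 : betaQ (1 / 18) (1 / 18) ∈ eighteenSpan := Submodule.subset_span ⟨1, rfl⟩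

/-- `β(1/18,1/2)` — DUPLICATION (`{1,8,9} ~ {1,1,16}`). -/
theorem a1_9 : betaQ (1 / 18) (1 / 2) ∈ eighteenSpan :=
  (betaQ_propTo_dupl (a := 1 / 18) (by norm_num)).symm.mem a1_1

/-- `β(4/9,1/2)` (orbit `{1,8,9}`). -/
theorem a8_9 : betaQ (4 / 9) (1 / 2) ∈ eighteenSpan := by
  have h := propTo_of_sameOrbit (N := 18) (p := (1, 9)) (q := (8, 9)) (by decide) (by decide)
    (by decide)
  norm_num at h
  exact h.mem a1_9

/-- `β(2/9,13/18)` — MIXED DUPLICATION (`{1,4,13} ~ {1,8,9}`). -/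
theorem a4_13 : betaQ (2 / 9) (13 / 18) ∈ eighteenSpan := by
  have h := betaQ_propTo_mixed (a := 2 / 9) (by norm_num)
  norm_num at h
  exact h.mem a8_9

/-- `β(4/9,4/9)` — DUPLICATION (`{2,8,8} ~ {1,8,9}`). -/
theorem a8_8 : betaQ (4 / 9) (4 / 9) ∈ eighteenSpan :=
  (betaQ_propTo_dupl (a := 4 / 9) (by norm_num)).mem a8_9

/-- `β(4/9,1/9)` (orbit `{2,8,8}`). -/
theorem a8_2 : betaQ (4 / 9) (1 / 9) ∈ eighteenSpan := by
  have h := propTo_of_sameOrbit (N := 18) (p := (8, 8)) (q := (8, 2)) (by decide) (by decide)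
    (by decide)
  norm_num at h
  exact h.mem a8_8

/-- `β(2/9,1/3)` — TRIPLICATION (`{4,6,8} ~ {2,8,8}`). -/
theorem a4_6 : betaQ (2 / 9) (1 / 3) ∈ eighteenSpan := by
  have h := betaQ_propTo_tripl0 (2 / 9) (by norm_num) (by norm_num)
  norm_num at h
  exact h.mem a8_2

/-- `β(4/9,2/9)` (orbit `{4,6,8}`). -/
theorem a8_4 : betaQ (4 / 9) (2 / 9) ∈ eighteenSpan := by
  have h := propTo_of_sameOrbit (N := 18) (p := (4, 6)) (q := (8, 4)) (by decide) (by decide)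
    (by decide)
  norm_num at h
  exact h.mem a4_6

/-- `β(1/18,1/3)` — TWISTED QUARTIC (`{1,6,11} ~ {4,6,8}`). -/
theorem a1_6 : betaQ (1 / 18) (1 / 3) ∈ eighteenSpan := by
  have h := betaQ_propTo_quarticTwist (1 / 18) (by norm_num) (by norm_num)
  norm_num at h
  exact h.mem a8_4

/-- `β(2/9,1/18)` (orbit `{1,4,13}`). -/
theorem a4_1 : betaQ (2 / 9) (1 / 18) ∈ eighteenSpan := by
  have h := propTo_of_sameOrbit (N := 18) (p := (4, 13)) (q := (4, 1)) (by decide) (by decide)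
    (by decide)
  norm_num at h
  exact h.mem a4_13

/-- `β(11/18,1/6)` — TRIPLICATION `3a+b=2` (`{3,4,11} ~ {1,4,13}`). -/
theorem a11_3 : betaQ (11 / 18) (1 / 6) ∈ eighteenSpan := by
  have h := betaQ_propTo_tripl1 (11 / 18) (by norm_num) (by norm_num)
  norm_num at h
  exact h.mem a4_1

/-! ## Class B -/

/-- `β(1/9,1/9) ∈ ⟨eighteenGens⟩`. -/
theorem b2_2 : betaQ (1 / 9) (1 / 9) ∈ eighteenSpan := Submodule.subset_span ⟨2, rfl⟩

/-- `β(1/9,1/2)` — DUPLICATION (`{2,7,9} ~ {2,2,14}`). -/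
theorem b2_9 : betaQ (1 / 9) (1 / 2) ∈ eighteenSpan :=
  (betaQ_propTo_dupl (a := 1 / 9) (by norm_num)).symm.mem b2_2

/-- `β(1/18,5/9)` — MIXED DUPLICATION (`{1,7,10} ~ {2,7,9}`). -/
theorem b1_10 : betaQ (1 / 18) (5 / 9) ∈ eighteenSpan := by
  have h := betaQ_propTo_mixed (a := 1 / 18) (by norm_num)
  norm_num at h
  exact h.mem b2_9

/-- `β(5/9,1/3)` — TRIPLICATION `3a+b=2` (`{2,6,10} ~ {2,2,14}`, a level-9 merge). -/
theorem b10_6 : betaQ (5 / 9) (1 / 3) ∈ eighteenSpan := betaQ_propTo_nine_135.mem b2_2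

/-- `β(5/9,1/18)` (orbit `{1,7,10}`). -/
theorem b10_1 : betaQ (5 / 9) (1 / 18) ∈ eighteenSpan :=
  (betaQ_propTo_symm (a := 1 / 18) (b := 5 / 9) (by norm_num) (by norm_num)).mem b1_10

/-- `β(5/18,1/6)` — TRIPLICATION (`{3,5,10} ~ {1,7,10}`). -/
theorem b5_3 : betaQ (5 / 18) (1 / 6) ∈ eighteenSpan := by
  have h := betaQ_propTo_tripl0 (5 / 18) (by norm_num) (by norm_num)
  norm_num at h
  exact h.mem b10_1

/-- `β(7/18,1/2)` (orbit `{2,7,9}`). -/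
theorem b7_9 : betaQ (7 / 18) (1 / 2) ∈ eighteenSpan := by
  have h := propTo_of_sameOrbit (N := 18) (p := (2, 9)) (q := (7, 9)) (by decide) (by decide)
    (by decide)
  norm_num at h
  exact h.mem b2_9

/-- `β(7/18,7/18)` — DUPLICATION (`{4,7,7} ~ {2,7,9}`). -/
theorem b7_7 : betaQ (7 / 18) (7 / 18) ∈ eighteenSpan :=
  (betaQ_propTo_dupl (a := 7 / 18) (by norm_num)).mem b7_9

/-- `β(1/9,5/9)` (orbit `{2,6,10}`). -/
theorem b2_10 : betaQ (1 / 9) (5 / 9) ∈ eighteenSpan := by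
  have h := propTo_of_sameOrbit (N := 18) (p := (10, 6)) (q := (2, 10)) (by decide) (by decide)
    (by decide)
  norm_num at h
  exact h.mem b10_6

/-- `β(1/3,7/18)` — QUARTIC (`{5,6,7} ~ {2,6,10}`). -/
theorem b6_7 : betaQ (1 / 3) (7 / 18) ∈ eighteenSpan := by
  have h := betaQ_propTo_quartic (1 / 9) (by norm_num) (by norm_num)
  norm_num at h
  exact h.symm.mem b2_10

/-! ## Class C -/

/-- `β(2/9,2/9) ∈ ⟨eighteenGens⟩`. -/
theorem c4_4 : betaQ (2 / 9) (2 / 9) ∈ eighteenSpan := Submodule.subset_span ⟨3, rfl⟩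

/-- `β(2/9,1/2)` — DUPLICATION (`{4,5,9} ~ {4,4,10}`). -/
theorem c4_9 : betaQ (2 / 9) (1 / 2) ∈ eighteenSpan :=
  (betaQ_propTo_dupl (a := 2 / 9) (by norm_num)).symm.mem c4_4

/-- `β(1/9,2/3)` — TRIPLICATION (`{2,4,12} ~ {4,4,10}`, a level-9 merge). -/
theorem c2_12 : betaQ (1 / 9) (2 / 3) ∈ eighteenSpan := betaQ_propTo_nine_126.mem c4_4

/-- `β(1/9,11/18)` — MIXED DUPLICATION (`{2,5,11} ~ {4,5,9}`). -/
theorem c2_11 : betaQ (1 / 9) (11 / 18) ∈ eighteenSpan := by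
  have h := betaQ_propTo_mixed (a := 1 / 9) (by norm_num)
  norm_num at h
  exact h.mem c4_9

/-- `β(1/9,5/18)` (orbit `{2,5,11}`). -/
theorem c2_5 : betaQ (1 / 9) (5 / 18) ∈ eighteenSpan := by
  have h := propTo_of_sameOrbit (N := 18) (p := (2, 11)) (q := (2, 5)) (by decide) (by decide)
    (by decide)
  norm_num at h
  exact h.mem c2_11

/-- `β(1/18,5/6)` — TRIPLICATION (`{1,2,15} ~ {2,5,11}`). -/
theorem c1_15 : betaQ (1 / 18) (5 / 6) ∈ eighteenSpan := by
  have h := betaQ_propTo_tripl0 (1 / 18) (by norm_num) (by norm_num)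
  norm_num at h
  exact h.mem c2_5

/-- `β(5/18,1/2)` (orbit `{4,5,9}`). -/
theorem c5_9 : betaQ (5 / 18) (1 / 2) ∈ eighteenSpan := by
  have h := propTo_of_sameOrbit (N := 18) (p := (4, 9)) (q := (5, 9)) (by decide) (by decide)
    (by decide)
  norm_num at h
  exact h.mem c4_9

/-- `β(5/18,5/18)` — DUPLICATION (`{5,5,8} ~ {4,5,9}`). -/
theorem c5_5 : betaQ (5 / 18) (5 / 18) ∈ eighteenSpan :=
  (betaQ_propTo_dupl (a := 5 / 18) (by norm_num)).mem c5_9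

/-- `β(2/9,1/9)` (orbit `{2,4,12}`). -/
theorem c4_2 : betaQ (2 / 9) (1 / 9) ∈ eighteenSpan := by
  have h := propTo_of_sameOrbit (N := 18) (p := (2, 12)) (q := (4, 2)) (by decide) (by decide)
    (by decide)
  norm_num at h
  exact h.mem c2_12

/-- `β(2/3,5/18)` — QUARTIC (`{1,5,12} ~ {2,4,12}`). -/
theorem c12_5 : betaQ (2 / 3) (5 / 18) ∈ eighteenSpan := by
  have h := betaQ_propTo_quartic (2 / 9) (by norm_num) (by norm_num)
  norm_num at h
  exact h.symm.mem c4_2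

/-! ## Class D -/

/-- `β(1/6,1/6) ∈ ⟨eighteenGens⟩`. -/
theorem d3_3 : betaQ (1 / 6) (1 / 6) ∈ eighteenSpan := Submodule.subset_span ⟨4, rfl⟩

/-- `β(1/6,1/2)` — DUPLICATION (`{3,6,9} ~ {3,3,12}`). -/
theorem d3_9 : betaQ (1 / 6) (1 / 2) ∈ eighteenSpan :=
  (betaQ_propTo_dupl (a := 1 / 6) (by norm_num)).symm.mem d3_3

/-- `β(1/3,1/2)` (orbit `{3,6,9}`). -/
theorem d6_9 : betaQ (1 / 3) (1 / 2) ∈ eighteenSpan := by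
  have h := propTo_of_sameOrbit (N := 18) (p := (3, 9)) (q := (6, 9)) (by decide) (by decide)
    (by decide)
  norm_num at h
  exact h.mem d3_9

/-- `β(1/3,1/3)` — DUPLICATION (`{6,6,6} ~ {3,6,9}`). -/
theorem d6_6 : betaQ (1 / 3) (1 / 3) ∈ eighteenSpan :=
  (betaQ_propTo_dupl (a := 1 / 3) (by norm_num)).mem d6_9

/-- `β(1/6,1/3)` (orbit `{3,6,9}`). -/
theorem d3_6 : betaQ (1 / 6) (1 / 3) ∈ eighteenSpan := by
  have h := propTo_of_sameOrbit (N := 18) (p := (3, 9)) (q := (3, 6)) (by decide) (by decide)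
    (by decide)
  norm_num at h
  exact h.mem d3_9

/-- `β(1/9,1/6)` — the LEVEL-18 COVER MERGE (`{2,3,13} ~ {3,6,9}`). -/
theorem d2_3 : betaQ (1 / 9) (1 / 6) ∈ eighteenSpan := betaQ_propTo_enneaCover.mem d3_6

/-- `β(7/18,4/9)` — TWISTED QUARTIC (`{3,7,8} ~ {2,3,13}`). -/
theorem d7_8 : betaQ (7 / 18) (4 / 9) ∈ eighteenSpan := by
  have h := betaQ_propTo_quarticTwist (1 / 9) (by norm_num) (by norm_num)
  norm_num at h
  exact h.symm.mem d2_3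

/-- `β(1/6,4/9)` (orbit `{3,7,8}`). -/
theorem d3_8 : betaQ (1 / 6) (4 / 9) ∈ eighteenSpan := by
  have h := propTo_of_sameOrbit (N := 18) (p := (7, 8)) (q := (3, 8)) (by decide) (by decide)
    (by decide)
  norm_num at h
  exact h.mem d7_8

/-- `β(1/18,7/9)` — QUARTIC (`{1,3,14} ~ {3,7,8}`). -/
theorem d1_14 : betaQ (1 / 18) (7 / 9) ∈ eighteenSpan := by
  have h := betaQ_propTo_quartic (1 / 18) (by norm_num) (by norm_num)
  norm_num at h
  exact h.mem d3_8

/-! ## The sector -/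

/-- **`V₁₈^I ⊆ ⟨x_π, β(1/18,1/18), β(1/9,1/9), β(2/9,2/9), β(1/6,1/6)⟩`.** -/
theorem firstSpan_eighteen_le : firstSpan 18 ≤ eighteenSpan := by
  refine firstSpan_le representsFirst18 (Submodule.subset_span ⟨0, rfl⟩) ?_
  intro p hp
  simp only [reps18, Finset.mem_insert, Finset.mem_singleton] at hp
  rcases hp with rfl | rfl | rfl | rfl | rfl | rfl | rfl | rfl | rfl | rfl | rfl | rfl | rfl |
    rfl | rfl | rfl | rfl | rfl | rfl | rfl | rfl | rfl | rfl | rfl | rfl | rfl | rfl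
  · norm_num; exact a1_1
  · norm_num; exact a1_9
  · norm_num; exact a4_13
  · norm_num; exact a8_8
  · norm_num; exact a4_6
  · norm_num; exact a1_6
  · norm_num; exact a11_3
  · norm_num; exact b2_2
  · norm_num; exact b2_9
  · norm_num; exact b1_10
  · norm_num; exact b10_6
  · norm_num; exact b5_3
  · norm_num; exact b7_7
  · norm_num; exact b6_7
  · norm_num; exact c4_4
  · norm_num; exact c4_9
  · norm_num; exact c2_12
  · norm_num; exact c2_11
  · norm_num; exact c1_15
  · norm_num; exact c5_5
  · norm_num; exact c12_5
  · norm_num; exact d3_3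
  · norm_num; exact d3_9
  · norm_num; exact d6_6
  · norm_num; exact d2_3
  · norm_num; exact d7_8
  · norm_num; exact d1_14

/-- The five generators lie in `V₁₈^I`, so `V₁₈^I` IS their span. -/
theorem firstSpan_eighteen_eq : firstSpan 18 = eighteenSpan := by
  refine le_antisymm firstSpan_eighteen_le (Submodule.span_le.mpr ?_)
  rintro x ⟨i, rfl⟩
  fin_cases i
  · exact xPi_mem_firstSpan 18
  · exact Submodule.subset_span (mem_insert_of_mem _ ⟨1, 1, 0, 0, le_rfl, le_rfl, by norm_num,
      by norm_num [eighteenGens]⟩)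
  · exact Submodule.subset_span (mem_insert_of_mem _ ⟨2, 2, 0, 0, by norm_num, by norm_num,
      by norm_num, by norm_num [eighteenGens]⟩)
  · exact Submodule.subset_span (mem_insert_of_mem _ ⟨4, 4, 0, 0, by norm_num, by norm_num,
      by norm_num, by norm_num [eighteenGens]⟩)
  · exact Submodule.subset_span (mem_insert_of_mem _ ⟨3, 3, 0, 0, by norm_num, by norm_num,
      by norm_num, by norm_num [eighteenGens]⟩)

/-- The periods of the generators:
`(π, Γ(1/18)²/Γ(1/9), Γ(1/9)²/Γ(2/9), Γ(2/9)²/Γ(4/9), Γ(1/6)²/Γ(1/3))`. -/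
theorem evalQ_eighteenGens : (fun i => evalQ (eighteenGens i)) =
    ![Real.pi, Real.Gamma (1 / 18) * Real.Gamma (1 / 18) / Real.Gamma (1 / 9),
      Real.Gamma (1 / 9) * Real.Gamma (1 / 9) / Real.Gamma (2 / 9),
      Real.Gamma (2 / 9) * Real.Gamma (2 / 9) / Real.Gamma (4 / 9),
      Real.Gamma (1 / 6) * Real.Gamma (1 / 6) / Real.Gamma (1 / 3)] := by
  funext i
  fin_cases i
  · exact evalQ_xPi
  · show evalQ (betaQ (1 / 18) (1 / 18)) = _
    rw [evalQ_betaQ (by norm_num) (by norm_num)]; norm_num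
  · show evalQ (betaQ (1 / 9) (1 / 9)) = _
    rw [evalQ_betaQ (by norm_num) (by norm_num)]; norm_num
  · show evalQ (betaQ (2 / 9) (2 / 9)) = _
    rw [evalQ_betaQ (by norm_num) (by norm_num)]; norm_num
  · show evalQ (betaQ (1 / 6) (1 / 6)) = _
    rw [evalQ_betaQ (by norm_num) (by norm_num)]; norm_num

/-- **The first-kind linear sector at level 18.** If `π, Γ(1/18)²/Γ(1/9), Γ(1/9)²/Γ(2/9),
Γ(2/9)²/Γ(4/9), Γ(1/6)²/Γ(1/3)` — one value per Deligne–Koblitz–Ogus class — are linearly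
independent over `K₀ = ℚ̄ ∩ ℝ`, the period map is injective on `V₁₈^I`: every `K₀`-linear
relation among first-kind level-18 Beta words and `π` with vanishing period is a consequence of
the three Kontsevich–Zagier rules. -/
theorem kz_levelEighteenFirst (h : LinearIndependent K₀ fun i => evalQ (eighteenGens i))
    {z : Q} (hz : z ∈ firstSpan 18) (h0 : evalQ z = 0) : z = 0 :=
  kz_first_of_le firstSpan_eighteen_le h hz h0

/-- The period map is injective on `V₁₈^I` (same hypothesis). -/
theorem evalQ_injOn_firstSpan_eighteen
    (h : LinearIndependent K₀ fun i => evalQ (eighteenGens i)) :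
    InjOn evalQ (firstSpan 18) := fun x hx y hy hxy => sub_eq_zero.mp
  (kz_levelEighteenFirst h ((firstSpan 18).sub_mem hx hy) (by rw [map_sub, hxy, sub_self]))

end SoloBlind

end Summit.KontsevichZagierPeriods.KontsevichZagierPeriods.Theorems
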